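import Literature.AlgebraicGeometry.AbelianSchemes.AbelianSchemeKOfL
import Literature.AlgebraicGeometry.AbelianSchemes.AbelianSchemeQuotientDualSideAction
import Literature.AlgebraicGeometry.AbelianSchemes.AbelianSchemeBaseChangeComp
import Literature.AlgebraicGeometry.Modules.EquivariantStructure
import HarnessLib

/-!
# `K(L)` stabilises Mumford's bundle: `(1 × t_σ)^* Λ(L) ≅ Λ(L)` for a section `σ ∈ K(L)(S)` of an abelian scheme `A/S`

Layer `Literature/AlgebraicGeometry/AbelianSchemes`, namespace `Literature.AlgebraicGeometry.AbelianSchemes.AbelianSchemeOver`.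
THEOREMS ONLY (no definition, no named fact, no instance, no notation, no `sorry`; net Literature debt 0).

Source: [MumfordAV1970] §13 (p. 125, proof of the Theorem «`X̂ = X⁄K(L)`»): the action of `K(L)` on the SECOND factor of
`X × X` lifts to Mumford's bundle `Λ(L) = m^*L ⊗ p₁^*L⁻¹ ⊗ p₂^*L⁻¹` — for `x ∈ K(L)`, `(1 × T_x)^*Λ(L) ≅ Λ(L)` because
`T_x^*L ≅ L` (up to the base) and `m ∘ (1 × T_x) = T_x ∘ m`; [MumfordAV1970] §8 pp. 78–80 (the same in characteristic `0`);
[MilneAV2008] I §8 (p. 40).  The tree has the FIELD case (★ `AbelianVarieties/MumfordSheafLinearisation.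
nonempty_pullback_whiskerLeft_translation_mumfordSheaf_iso`, for `P ∈ K(Θ)`); THIS FILE is the same statement for an abelian
scheme `A → S` over an ARBITRARY base and a SECTION `σ ∈ K(L)(S)` (★ `AbelianSchemeKOfL.MemKOfL`), by pure class calculus in
`Ȟ¹(–, 𝒪^×)` (★ `mumfordClass`, ★ `pullback_whiskerLeft_mumfordClass(_eq_one_iff)`) — NO theorem of the square, NO dual pair:

* §1 `translation_eq_rightUnitor_inv_comp_whiskerLeft_comp_mul` — `t_σ = (A ≅ A × S) ≫ (1_A × σ) ≫ m` (commutative `A`);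
  `cechPic_pullback_translation_of_mumfordClass_eq_one` — for `σ ∈ K(L)(S)`: `t_σ^*[L] = [L] · [A → S →σ A]^*[L]`
  («`T_σ^*L ≅ L ⊗ π^*σ^*L`», [MumfordFogartyKirwan1994] App. 7B);
* §2 **`cechPic_pullback_whiskerLeft_translation_mumfordClass`** — `(1 × t_σ)^*[Λ(L)] = [Λ(L)]` for `σ ∈ K(L)(S)`;
  **`nonempty_pullback_whiskerLeft_translation_mumfordBundle_iso`** — `(1 × t_σ)^*Λ(L) ≅ Λ(L)` as modules (`L` of rank one);
  `nonempty_pullback_prodTranslationActionOver_autHom_mumfordBundle_iso` — the same in the currency of the action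
  `ρ = 1 × t_•` of ★ `AbelianSchemeQuotientDualSideAction.prodTranslationActionOver A A u K hcov` (second factor `A` itself):
  the hypothesis `hT` («`σ_g^*E ≅ E` for every `g`») of the rigid-descent normalisation (★
  `RigidDescentAlongUnitSection.exists_equivariantStructure_of_restrictAlong_unitSection` and its base-change edition);
* §3 `translationActionOver_autHom_comp_unitSection_baseChange` — the unit section `(ε_B ∘ π, id) : Ah → B ×_S Ah` of
  `B_{Ah}` intertwines `t_k` with `1 × t_k` (★ `AbelianSchemeQuotientPoincareEquivariant.translation_comp_unitSection_baseChange`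
  is the same statement typed with the dual `Â` of a dual pair as second factor; here the second factor is ANY abelian scheme
  `Ah`) — the hypothesis `hι` of the same normalisation.

Cell `hodgecm-mathlib` (D-0151), FLOOR 0 programme P1, sub-line `Cruxes/HDel/Lines/F3DualAbelianScheme` (author of record
B-plan1 (g19)), stub (M) `stub_F3M`, inner step (M-b) «`Â := A⁄K`, `𝒫 :=` descent of `Λ(L)` along `1 × π`» ((M) cut v0
5c279ade): this file is piece (b1)+(b1′) of the census `B-provers/B-p16/g18/CENSUS-F3Mb-ConstantKQuotientPoincare.B-p16g18.md`
— the two hypotheses `hT`, `hι` under which the `K`-linearisation of `Λ(L)` is normalised along `{0} × A`.  Count-neutral; HC_CM is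
proved only modulo the 7 printed citations until rung 0 closes; nothing here is about HC.

Mathlib searched (pin): `CartesianMonoidalCategory.rightUnitor_inv_fst`, `rightUnitor_inv_snd`, `MonObj.comp_mul`,
`Over.whiskerLeft_left_fst`; Mathlib has no abelian schemes and no Mumford bundle.

## References
* [MumfordAV1970] D. Mumford, *Abelian Varieties* (1970), §8 pp. 78–80, §13 (p. 123 and Thm. p. 125 with its proof).
* [MumfordFogartyKirwan1994] D. Mumford, J. Fogarty, F. Kirwan, *GIT* 3rd ed. (1994), Ch. 6 §2 Def. 6.2 (p. 120);
  App. 7B, Definition of `H(L)` (p. 240).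
* [MilneAV2008] J. S. Milne, *Abelian Varieties* (v2.00, 2008), I §8 (p. 40).
* [Hartshorne1977] R. Hartshorne, *Algebraic Geometry* (1977), II Ex. 6.8 (a), III Ex. 4.5.
-/

set_option autoImplicit false

noncomputable section

-- `Scheme.Modules` / `SheafOfModules` are not reducible; `(A.X ⊗ A.X).left = pullback A.X.hom A.X.hom` holds by `rfl` only.
set_option backward.isDefEq.respectTransparency false

universe u

open CategoryTheory CategoryTheory.Limits AlgebraicGeometry MonoidalCategory CartesianMonoidalCategory
open scoped MonObj

namespace Literature.AlgebraicGeometry.AbelianSchemes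

open Literature.AlgebraicGeometry.Motives Literature.AlgebraicGeometry.AbelianVarieties
  Literature.AlgebraicGeometry.Modules Literature.AlgebraicGeometry.RelativeSpec

namespace AbelianSchemeOver

variable {S : Scheme.{u}} (A : AbelianSchemeOver S)

/-- `x · z · u⁻¹ · (v · z)⁻¹ = x · u⁻¹ · v⁻¹` in a commutative group (class bookkeeping). [folklore] -/
private theorem cancel_twist {G : Type*} [CommGroup G] (x z u v : G) : x * z * u⁻¹ * (v * z)⁻¹ = x * u⁻¹ * v⁻¹ := by
  rw [mul_inv_rev, ← mul_assoc, mul_right_comm (x * z) u⁻¹ z⁻¹, mul_inv_cancel_right]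

/-! ## §1 Translation by a section through `1_A × σ`, and the class `t_σ^*[L]` for `σ ∈ K(L)(S)` -/

section Translation

variable [IsCommMonObj A.X] (σ : A.Sections)

omit [IsCommMonObj A.X] in
/-- Any `S`-morphism followed by the constant section `A → S →σ A` is the constant section at `σ` of its source
(`𝟙_ (Over S)` is terminal). [cite: GortzWedhorn2023, Def./Rem. 27.1 (p. 604)] -/
theorem comp_toUnit_comp_of_hom {Z : Over S} (f : Z ⟶ A.X) : f ≫ (toUnit A.X ≫ σ) = toUnit Z ≫ σ := by
  rw [← Category.assoc, toUnit_unique (f ≫ toUnit A.X) (toUnit Z)]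

/-- **`t_σ = (A ≅ A ×_S S) ≫ (1_A × σ) ≫ m`** for a COMMUTATIVE `A`: translation by the section `σ` (`x ↦ σ·x`, ★
`translation`) is right translation `x ↦ x·σ`, i.e. the group law after the slice `1_A × σ`.
[cite: MumfordFogartyKirwan1994, App. 7B, Definition of H(L) (p. 240)] -/
theorem translation_eq_rightUnitor_inv_comp_whiskerLeft_comp_mul :
    A.translation σ = (ρ_ A.X).inv ≫ (A.X ◁ σ) ≫ μ[A.X] := by
  rw [A.whiskerLeft_comp_mul_eq σ, MonObj.comp_mul, rightUnitor_inv_fst, ← Category.assoc, rightUnitor_inv_snd,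
    translation, mul_comm]

/-- **`t_σ^*c = c · (A → S →σ A)^*c` when `(1_A × σ)^*Λ(c) = 1`** («`T_σ^*L ≅ L ⊗ π^*σ^*L` for `σ ∈ K(L)(S)`», the
translation form of membership ★ `pullback_whiskerLeft_mumfordClass_eq_one_iff` read on `A` itself through
`t_σ = (A ≅ A × S) ≫ (1 × σ) ≫ m`). [cite: MumfordFogartyKirwan1994, App. 7B, Definition of H(L) (p. 240)]
[cite: MumfordAV1970, §13 (p. 123)] -/
theorem cechPic_pullback_translation_of_mumfordClass_eq_one (c : CechPic A.left)
    (hσ : CechPic.pullback (A.X ◁ σ).left (A.mumfordClass c) = 1) :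
    CechPic.pullback (A.translation σ).left c = c * CechPic.pullback (toUnit A.X ≫ σ).left c := by
  have h := congrArg (CechPic.pullback (ρ_ A.X).inv.left) ((A.pullback_whiskerLeft_mumfordClass_eq_one_iff c σ).1 hσ)
  rw [map_mul, ← pullback_comp_left, ← pullback_comp_left, ← pullback_comp_left,
    ← A.translation_eq_rightUnitor_inv_comp_whiskerLeft_comp_mul σ, rightUnitor_inv_fst, Over.id_left,
    CechPic.pullback_id_apply, ← Category.assoc, rightUnitor_inv_snd] at h
  exact h

end Translation

/-! ## §2 `(1 × t_σ)^* Λ(L) ≅ Λ(L)` for `σ ∈ K(L)(S)` -/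

section Stabilizer

variable [IsCommMonObj A.X] (σ : A.Sections)

/-- **`(1 × t_σ)^*[Λ(L)] = [Λ(L)]` in `Ȟ¹(A ×_S A, 𝒪^×)` for `σ ∈ K(L)(S)`** (class form): with `c = [L]`,
`(1 × t_σ)^*[Λ] = (m ≫ t_σ)^*c · (p₁^*c)⁻¹ · ((p₂ ≫ t_σ)^*c)⁻¹` (★ `pullback_whiskerLeft_mumfordClass`, `(1 × t_σ) ≫ m = m ≫ t_σ`
★ `whiskerLeft_translation_comp_mul`), and `t_σ^*c = c · π^*σ^*c` (§1) contributes the same factor `[A × A → S →σ A]^*c` to the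
first and third terms. [cite: MumfordAV1970, §13 (Thm. p. 125, proof)] [cite: MilneAV2008, I §8 (p. 40)] -/
theorem cechPic_pullback_whiskerLeft_translation_mumfordClass (c : CechPic A.left)
    (hσ : CechPic.pullback (A.X ◁ σ).left (A.mumfordClass c) = 1) :
    CechPic.pullback (A.X ◁ A.translation σ).left (A.mumfordClass c) = A.mumfordClass c := by
  have ht := A.cechPic_pullback_translation_of_mumfordClass_eq_one σ c hσ
  rw [A.pullback_whiskerLeft_mumfordClass, A.whiskerLeft_translation_comp_mul σ,
    pullback_comp_left (μ[A.X]) (A.translation σ), pullback_comp_left (snd A.X A.X) (A.translation σ), ht, map_mul, map_mul,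
    ← pullback_comp_left (μ[A.X]) (toUnit A.X ≫ σ), ← pullback_comp_left (snd A.X A.X) (toUnit A.X ≫ σ),
    A.comp_toUnit_comp_of_hom σ, A.comp_toUnit_comp_of_hom σ, mumfordClass]
  exact cancel_twist _ _ _ _

/-- **`(1 × t_σ)^* Λ(L) ≅ Λ(L)` as `𝒪_{A ×_S A}`-modules, for `L` of rank one and a section `σ ∈ K(L)(S)`** — [MumfordAV1970]
§13 «the action of `K(L)` on the second factor lifts to `Λ(L)`», existence of the lift for one element (the NORMALISED,
cocycle-respecting choice is rigid descent along `{0} × A`, downstream).  Rank-one modules are classified by their classes (★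
`nonempty_iso_iff_detClass_eq`). [cite: MumfordAV1970, §13 (Thm. p. 125, proof)] [cite: MilneAV2008, I §8 (p. 40)]
[cite: Hartshorne1977, III Ex. 4.5] -/
theorem nonempty_pullback_whiskerLeft_translation_mumfordBundle_iso {L : A.left.Modules} (hL : HasRank L 1)
    (hσ : A.MemKOfL L σ) :
    Nonempty ((Scheme.Modules.pullback (A.X ◁ A.translation σ).left).obj (A.mumfordBundle L) ≅ A.mumfordBundle L) := by
  have hΛ := A.hasRank_mumfordBundle hL
  have hΛ₁ := HasRank.isFiniteLocallyFree' hΛ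
  refine (nonempty_iso_iff_detClass_eq (hasRank_pullback _ hΛ) hΛ (hΛ₁.pullback _) hΛ₁).2 ?_
  rw [detClass_pullback _ hΛ₁, A.detClass_mumfordBundle hL hΛ₁]
  exact A.cechPic_pullback_whiskerLeft_translation_mumfordClass σ _ ((A.memKOfL_iff_mumfordClass hL _).1 hσ)

variable {Y : Scheme.{u}} (u : S ⟶ Y) (K : Subgroup A.Sections) [Finite K] [Y.IsSeparated]
  [IsSeparated (A.X.hom ≫ u)] [S.IsSeparated]
  (hcov : ∀ x : A.left, ∃ O : (A.translationActionOver u K).StableAffineOpens, x ∈ O.1)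

/-- **`σ_k^* Λ(L) ≅ Λ(L)` for the action `ρ = 1 × t_•` of a finite `K ≤ K(L)(S)` on `A ×_S A`** (★
`prodTranslationActionOver A A u K hcov`, over `1 × π : A ×_S A → A ×_S (A⁄K)`; `ρ.autHom k = (A ◁ t_k).left` by `rfl`) — the
hypothesis `hT` of the rigid-descent normalisation of the `K`-linearisation of `Λ(L)`.
[cite: MumfordAV1970, §13 (Thm. p. 125, proof)] [cite: MumfordFogartyKirwan1994, Ch. 1 §3 Definition 1.6 (p. 30)] -/
theorem nonempty_pullback_prodTranslationActionOver_autHom_mumfordBundle_iso {L : A.left.Modules} (hL : HasRank L 1)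
    (hKL : ∀ k : K, A.MemKOfL L (k : A.Sections)) (k : K) :
    Nonempty ((Scheme.Modules.pullback ((prodTranslationActionOver A A u K hcov).autHom k)).obj (A.mumfordBundle L) ≅
      A.mumfordBundle L) :=
  A.nonempty_pullback_whiskerLeft_translation_mumfordBundle_iso (k : A.Sections) hL (hKL k)

end Stabilizer

/-! ## §3 The unit section of `B ×_S Ah → Ah` is `K′`-equivariant (ANY second factor `Ah`) -/

section Slice

variable (B Ah : AbelianSchemeOver S) {Y : Scheme.{u}} (u : S ⟶ Y) (K' : Subgroup Ah.Sections) [Finite K'] [Y.IsSeparated]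
  [IsSeparated (Ah.X.hom ≫ u)] [S.IsSeparated]
  (hcov' : ∀ x : Ah.left, ∃ O : (Ah.translationActionOver u K').StableAffineOpens, x ∈ O.1)

/-- **`t_k ≫ ε = ε ≫ (1 × t_k)`**: the unit section `ε = (e_B ∘ π, id) : Ah → B ×_S Ah` of the base-changed abelian scheme
`B_{Ah}` intertwines the translation `t_k` of `Ah` with `1 × t_k` (both projections agree: ★ `unitSection_baseChange_comp_fst`,
★ `prodTranslationActionOver_aut_hom_fst/snd`).  Same statement and proof as ★ `translation_comp_unitSection_baseChange`
(second factor the dual `Â` of a dual pair), for an ARBITRARY second factor `Ah` — the hypothesis `hι` of rigid descent along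
the unit section of `B_{Ah}`. [cite: MumfordAV1970, §8 (pp. 78–80)] -/
theorem translationActionOver_autHom_comp_unitSection_baseChange (k : K') :
    (Ah.translationActionOver u K').autHom k ≫ (B.baseChange Ah.X.hom).unitSection =
      (B.baseChange Ah.X.hom).unitSection ≫ (prodTranslationActionOver B Ah u K' hcov').autHom k := by
  -- the unit section, typed into Mathlib's `pullback` (definitionally the carrier of `B_{Ah}` and of `B ⊗ Ah`)
  let ε' : Ah.X.left ⟶ pullback B.X.hom Ah.X.hom := (B.baseChange Ah.X.hom).unitSection
  have hk : (Ah.translationActionOver u K').autHom k = (Ah.translation (k : Ah.Sections)).left :=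
    Ah.translationActionOver_aut_hom u K' k
  have e1 : ε' ≫ pullback.fst B.X.hom Ah.X.hom = Ah.X.hom ≫ B.unitSection := B.unitSection_baseChange_comp_fst Ah.X.hom
  have e2 : ε' ≫ pullback.snd B.X.hom Ah.X.hom = 𝟙 _ := (B.baseChange Ah.X.hom).unitSection_comp_hom
  have e3 : (Ah.translation (k : Ah.Sections)).left ≫ Ah.X.hom = Ah.X.hom := Over.w (Ah.translation (k : Ah.Sections))
  have f1 := prodTranslationActionOver_aut_hom_fst B Ah u K' hcov' k
  have f2 := prodTranslationActionOver_aut_hom_snd B Ah u K' hcov' k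
  change (Ah.translationActionOver u K').autHom k ≫ ε' = ε' ≫ ((prodTranslationActionOver B Ah u K' hcov').aut k).hom
  apply pullback.hom_ext
  · calc ((Ah.translationActionOver u K').autHom k ≫ ε') ≫ pullback.fst B.X.hom Ah.X.hom
          = (Ah.translationActionOver u K').autHom k ≫ (ε' ≫ pullback.fst B.X.hom Ah.X.hom) := Category.assoc _ _ _
      _ = ((Ah.translation (k : Ah.Sections)).left ≫ Ah.X.hom) ≫ B.unitSection := by
            rw [e1, hk]; exact (Category.assoc _ _ _).symm
      _ = ε' ≫ pullback.fst B.X.hom Ah.X.hom := by rw [e3]; exact e1.symm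
      _ = ε' ≫ (((prodTranslationActionOver B Ah u K' hcov').aut k).hom ≫ pullback.fst B.X.hom Ah.X.hom) :=
            (congrArg (fun x => ε' ≫ x) f1).symm
      _ = (ε' ≫ ((prodTranslationActionOver B Ah u K' hcov').aut k).hom) ≫ pullback.fst B.X.hom Ah.X.hom :=
            (Category.assoc _ _ _).symm
  · calc ((Ah.translationActionOver u K').autHom k ≫ ε') ≫ pullback.snd B.X.hom Ah.X.hom
          = (Ah.translationActionOver u K').autHom k ≫ (ε' ≫ pullback.snd B.X.hom Ah.X.hom) := Category.assoc _ _ _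
      _ = (Ah.translation (k : Ah.Sections)).left := by rw [e2, hk]; exact Category.comp_id _
      _ = (ε' ≫ pullback.snd B.X.hom Ah.X.hom) ≫ (Ah.translation (k : Ah.Sections)).left := by
            rw [e2]; exact (Category.id_comp _).symm
      _ = ε' ≫ (((prodTranslationActionOver B Ah u K' hcov').aut k).hom ≫ pullback.snd B.X.hom Ah.X.hom) :=
            (Category.assoc _ _ _).trans (congrArg (fun x => ε' ≫ x) f2).symm
      _ = (ε' ≫ ((prodTranslationActionOver B Ah u K' hcov').aut k).hom) ≫ pullback.snd B.X.hom Ah.X.hom :=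
            (Category.assoc _ _ _).symm

end Slice

end AbelianSchemeOver

end Literature.AlgebraicGeometry.AbelianSchemes

end
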